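import Literature.Analysis.FunctionSpaces.PolchinskiContinuityAtZero
import Literature.Analysis.FunctionSpaces.PolchinskiSmoothedJets
import Literature.Analysis.FunctionSpaces.PolchinskiTemperedFamily
import HarnessLib

/-!
# Continuity at `t = 0⁺` of `t ↦ E_{ν_t}[G_t]` for the smoothed class
# (Bauerschmidt–Bodineau–Dagallier, proof of Theorem 3: the boundary values at `t = 0` when `V₀` is
# unbounded above)

Topic `Literature/Analysis/FunctionSpaces`; "proof architecture" file behind the named fact
`Polchinski.BauerschmidtBodineau_multiscaleBakryEmery` ([BBD] Theorem 3, `MultiscaleBakryEmery.lean`),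
companion of `PolchinskiContinuityAtZero.lean`.

`PolchinskiContinuityAtZero.lean` proves `E_{ν_t}[G_t] → E_{ν_0}[G₀]` (`t → 0⁺`) from UNIFORM convergence
`G_t → G₀`, which holds when `V₀ ∈ C_b⁴` (then `Z_t = E_{C_t}[e^{−V₀}(·+ζ)] ≥ e^{−sup V₀} > 0`).  For initial
data `e^{−V₀} = Ψ` of the smoothed class (`Ψ ∈ C_b⁴`, `Ψ > 0` with a Gaussian lower bound
`Ψ ≥ c₁e^{−c₂‖y‖²}`, no upper bound on `V₀`) the quotients `P_{0,t}F = W_t/Z_t` only converge locally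
uniformly.  This file proves the two boundary values of [BBD]'s proof of Theorem 3 (p0016 L47–90,
«`Ent_{ν₀}(F) = …`», «`(∇√P_{0,0}F)²_{Ċ_0} = (∇√F)²_{Ċ_0}`») for this class, through a TEMPERED principle:
if the `e^{−V_t}`-weighted integrands satisfy `|Z_tG_t − e^{−V₀}G₀|(y) ≤ ε(1+‖y‖²)` eventually, uniformly in
`y`, then `E_{ν_t}[G_t] → E_{ν_0}[G₀]` (the fluctuation measures `P_{C_∞−C_t}` have second moments bounded
near `t = 0`, by Fernique's theorem).  The tempered hypothesis is verified by uniform convergence on the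
region `{Ψ ≥ η}` (where `Z_t ≥ η/2` eventually) and the Gaussian lower bound off it (`‖y‖²` is large there).

## Main results (sorry-free; no new definitions, no new named facts)

* `tendsto_renormExpect_nhdsWithin_zero_tempered` — the tempered principle;
* **`tendsto_renormExpect_comp_semigroup_zero_smoothed`** — `E_{ν_t}[Φ(P_{0,t}F)] → ∫ Φ(F) dν₀`;
* **`tendsto_renormExpect_sqrtEnergy_zero_smoothed`** —
  `E_{ν_t}[(∇√P_{0,t}F)²_{Ċ_t}] → ∫ Σ Ċ_0^{kl}∂_kF∂_lF/(4F) dν₀`.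

Nothing here concerns Yang–Mills (no gauge instance of (e:assCt-mon) is in print; R4 =
`BalabanLadder.UV` only).

## References

* [BauerschmidtBodineauDagallier2023] R. Bauerschmidt, T. Bodineau, B. Dagallier, Probab. Surveys 21
  (2024) 200–290, arXiv:2307.07619 — Theorem 3 proof p0016 L47–90; Definition 2; Proposition 8.
* [DapratoZabczyk1992] G. Da Prato, J. Zabczyk, Stochastic Equations in Infinite Dimensions — Thm 2.7
  (Fernique).
* [Rudin1976] W. Rudin, Principles of Mathematical Analysis — Thm 7.9–7.11.
-/

noncomputable section

-- nested operator-norm instances `E →L[ℝ] E →L[ℝ] ℝ`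
set_option maxSynthPendingDepth 3

open MeasureTheory ProbabilityTheory Filter Topology Set
open scoped RealInnerProductSpace Matrix MatrixOrder

namespace Literature.Analysis.FunctionSpaces

namespace Polchinski

variable {N : ℕ}

/-! ### Helpers: algebra of uniform convergence along a filter, with eventual bounds -/

section Unif

variable {α : Type*} {l : Filter ℝ}

/-- A convergent scalar family is a uniformly convergent (constant-in-space) family. [folklore] -/
private theorem unifE_scalar {c : ℝ → ℝ} {c0 : ℝ} (hc : Tendsto c l (𝓝 c0)) :
    ∀ ε : ℝ, 0 < ε → ∀ᶠ t in l, ∀ _y : α, |c t - c0| ≤ ε := by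
  intro ε hε
  filter_upwards [Metric.tendsto_nhds.1 hc ε hε] with t ht y
  rw [Real.dist_eq] at ht
  exact ht.le

/-- Uniform convergence: differences. [cite: Rudin1976, Thm 7.9] -/
private theorem unifE_sub {A B : ℝ → α → ℝ} {A0 B0 : α → ℝ}
    (hA : ∀ ε : ℝ, 0 < ε → ∀ᶠ t in l, ∀ y, |A t y - A0 y| ≤ ε)
    (hB : ∀ ε : ℝ, 0 < ε → ∀ᶠ t in l, ∀ y, |B t y - B0 y| ≤ ε) :
    ∀ ε : ℝ, 0 < ε → ∀ᶠ t in l, ∀ y, |(A t y - B t y) - (A0 y - B0 y)| ≤ ε := by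
  intro ε hε
  filter_upwards [hA (ε / 2) (half_pos hε), hB (ε / 2) (half_pos hε)] with t h1 h2 y
  have he : (A t y - B t y) - (A0 y - B0 y) = (A t y - A0 y) - (B t y - B0 y) := by ring
  rw [he]
  exact (abs_sub _ _).trans (by linarith [h1 y, h2 y])

/-- Uniform convergence: products of families with eventual bounds. [cite: Rudin1976, Thm 7.9] -/
private theorem unifE_mul {A B : ℝ → α → ℝ} {A0 B0 : α → ℝ} {KA KB : ℝ}
    (hA : ∀ ε : ℝ, 0 < ε → ∀ᶠ t in l, ∀ y, |A t y - A0 y| ≤ ε)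
    (hB : ∀ ε : ℝ, 0 < ε → ∀ᶠ t in l, ∀ y, |B t y - B0 y| ≤ ε)
    (bA : ∀ᶠ t in l, ∀ y, |A t y| ≤ KA) (bB0 : ∀ y, |B0 y| ≤ KB) :
    ∀ ε : ℝ, 0 < ε → ∀ᶠ t in l, ∀ y, |A t y * B t y - A0 y * B0 y| ≤ ε := by
  intro ε hε
  filter_upwards [hA (ε / 2 / (|KB| + 1)) (by positivity), hB (ε / 2 / (|KA| + 1)) (by positivity), bA]
    with t h1 h2 hbA y
  have he : A t y * B t y - A0 y * B0 y = A t y * (B t y - B0 y) + (A t y - A0 y) * B0 y := by ring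
  rw [he]
  have hA' : |A t y| ≤ |KA| := (hbA y).trans (le_abs_self _)
  have hB' : |B0 y| ≤ |KB| := (bB0 y).trans (le_abs_self _)
  calc |A t y * (B t y - B0 y) + (A t y - A0 y) * B0 y|
      ≤ |A t y| * |B t y - B0 y| + |A t y - A0 y| * |B0 y| := by
        refine (abs_add_le _ _).trans ?_
        rw [abs_mul, abs_mul]
    _ ≤ |KA| * (ε / 2 / (|KA| + 1)) + (ε / 2 / (|KB| + 1)) * |KB| :=
        add_le_add (mul_le_mul hA' (h2 y) (abs_nonneg _) (abs_nonneg _))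
          (mul_le_mul (h1 y) hB' (abs_nonneg _) (by positivity))
    _ ≤ ε / 2 + ε / 2 := by
        refine add_le_add ?_ ?_
        · rw [mul_div_assoc', div_le_iff₀ (by positivity)]
          nlinarith [abs_nonneg KA]
        · rw [div_mul_eq_mul_div, div_le_iff₀ (by positivity)]
          nlinarith [abs_nonneg KB]
    _ = ε := by ring

/-- Uniform convergence: inverses of families eventually bounded below. [cite: Rudin1976, Thm 7.9] -/
private theorem unifE_inv {A : ℝ → α → ℝ} {A0 : α → ℝ} {m : ℝ}
    (hA : ∀ ε : ℝ, 0 < ε → ∀ᶠ t in l, ∀ y, |A t y - A0 y| ≤ ε)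
    (hm : 0 < m) (bA : ∀ᶠ t in l, ∀ y, m ≤ A t y) (bA0 : ∀ y, m ≤ A0 y) :
    ∀ ε : ℝ, 0 < ε → ∀ᶠ t in l, ∀ y, |(A t y)⁻¹ - (A0 y)⁻¹| ≤ ε := by
  intro ε hε
  filter_upwards [hA (ε * m ^ 2) (by positivity), bA] with t h1 hbA y
  have hAt : 0 < A t y := hm.trans_le (hbA y)
  have hA0 : 0 < A0 y := hm.trans_le (bA0 y)
  rw [inv_sub_inv hAt.ne' hA0.ne', abs_div, abs_mul, abs_of_pos hAt, abs_of_pos hA0,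
    div_le_iff₀ (mul_pos hAt hA0), abs_sub_comm]
  calc |A t y - A0 y| ≤ ε * m ^ 2 := h1 y
    _ = ε * (m * m) := by ring
    _ ≤ ε * (A t y * A0 y) :=
        mul_le_mul_of_nonneg_left (mul_le_mul (hbA y) (bA0 y) hm.le hAt.le) hε.le

/-- Uniform convergence: finite sums. [cite: Rudin1976, Thm 7.9] -/
private theorem unifE_sum {ι : Type*} (S : Finset ι) {A : ι → ℝ → α → ℝ} {A0 : ι → α → ℝ}
    (hA : ∀ i ∈ S, ∀ ε : ℝ, 0 < ε → ∀ᶠ t in l, ∀ y, |A i t y - A0 i y| ≤ ε) :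
    ∀ ε : ℝ, 0 < ε → ∀ᶠ t in l, ∀ y, |(∑ i ∈ S, A i t y) - ∑ i ∈ S, A0 i y| ≤ ε := by
  intro ε hε
  have hev : ∀ i ∈ S, ∀ᶠ t in l, ∀ y, |A i t y - A0 i y| ≤ ε / (S.card + 1) :=
    fun i hi => hA i hi _ (by positivity)
  filter_upwards [(Finset.eventually_all S).2 hev] with t ht y
  rw [← Finset.sum_sub_distrib]
  calc |∑ i ∈ S, (A i t y - A0 i y)| ≤ ∑ i ∈ S, |A i t y - A0 i y| := Finset.abs_sum_le_sum_abs _ _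
    _ ≤ ∑ i ∈ S, ε / (S.card + 1) := Finset.sum_le_sum fun i hi => ht i hi y
    _ = S.card * (ε / (S.card + 1)) := by rw [Finset.sum_const, nsmul_eq_mul]
    _ ≤ ε := by
        rw [mul_div_assoc', div_le_iff₀ (by positivity)]
        nlinarith

/-- Uniform convergence: composition with a uniformly continuous function. [cite: Rudin1976, Thm 7.9] -/
private theorem unifE_comp {A : ℝ → α → ℝ} {A0 : α → ℝ} {Φ : ℝ → ℝ} (hΦ : UniformContinuous Φ)
    (hA : ∀ ε : ℝ, 0 < ε → ∀ᶠ t in l, ∀ y, |A t y - A0 y| ≤ ε) :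
    ∀ ε : ℝ, 0 < ε → ∀ᶠ t in l, ∀ y, |Φ (A t y) - Φ (A0 y)| ≤ ε := by
  intro ε hε
  obtain ⟨δ, hδ, hΦδ⟩ := Metric.uniformContinuous_iff.1 hΦ ε hε
  filter_upwards [hA (δ / 2) (half_pos hδ)] with t ht y
  have h : dist (A t y) (A0 y) < δ := by
    rw [Real.dist_eq]; linarith [ht y]
  have := hΦδ h
  rw [Real.dist_eq] at this
  exact this.le

/-- Restriction of a uniform statement to a subtype. [folklore] -/
private theorem unifE_restrict {E : Type*} (p : E → Prop) {A : ℝ → E → ℝ} {A0 : E → ℝ}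
    (hA : ∀ ε : ℝ, 0 < ε → ∀ᶠ t in l, ∀ y, |A t y - A0 y| ≤ ε) :
    ∀ ε : ℝ, 0 < ε → ∀ᶠ t in l, ∀ y : {y : E // p y}, |A t y.1 - A0 y.1| ≤ ε :=
  fun ε hε => (hA ε hε).mono fun _ h y => h y.1

end Unif

/-! ### Second moments of the fluctuation measures near `t = 0` -/

section Moments

variable (D : CovDecomposition N)

/-- **Uniform second-moment bound of `P_{C_∞−C_t}` for `t` near `0⁺`**: there is `M₂` with
`E_{C_∞−C_t}‖w‖² ≤ M₂` for all small `t ≥ 0` (Fernique: `E e^{a‖w‖²}` is bounded uniformly over covariances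
with bounded entries; `‖w‖² ≤ a⁻¹e^{a‖w‖²}`). [cite: DapratoZabczyk1992, Thm 2.7] -/
theorem eventually_integral_norm_sq_Cinf_sub_le :
    ∃ M₂ : ℝ, 0 ≤ M₂ ∧ ∀ᶠ t in 𝓝[Ici (0 : ℝ)] 0,
      Integrable (fun w : EuclideanSpace ℝ (Fin N) => ‖w‖ ^ 2) (multivariateGaussian 0 (D.Cinf - D.C t)) ∧
      ∫ w, ‖w‖ ^ 2 ∂(multivariateGaussian 0 (D.Cinf - D.C t)) ≤ M₂ := by
  obtain ⟨cF, hcF, BF, hF⟩ := exists_integral_exp_mul_norm_sq_gaussian_le (ι := Fin N)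
  set L : ℝ := (∑ i, ∑ j, |D.Cinf i j|) + 1 with hL
  have hL0 : 0 < L := by positivity
  have evL : ∀ᶠ t in 𝓝[Ici (0 : ℝ)] 0, (∑ i, ∑ j, |(D.Cinf - D.C t) i j|) ≤ L := by
    have hcont : ∀ i j, Tendsto (fun t => |(D.Cinf - D.C t) i j|) (𝓝 0) (𝓝 |D.Cinf i j|) := by
      intro i j
      have h := ((D.hasDerivAt_C 0 le_rfl i j).continuousAt.tendsto).const_sub (D.Cinf i j)
      rw [D.C_zero] at h
      simp only [Matrix.zero_apply, sub_zero] at h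
      have h' := h.abs
      refine h'.congr fun t => ?_
      simp only [Matrix.sub_apply]
    have hsum : Tendsto (fun t => ∑ i, ∑ j, |(D.Cinf - D.C t) i j|) (𝓝 0)
        (𝓝 (∑ i, ∑ j, |D.Cinf i j|)) :=
      tendsto_finsetSum _ fun i _ => tendsto_finsetSum _ fun j _ => hcont i j
    have hev : ∀ᶠ t in 𝓝 (0 : ℝ), (∑ i, ∑ j, |(D.Cinf - D.C t) i j|) < L :=
      (tendsto_order.1 hsum).2 L (by rw [hL]; linarith)
    exact (hev.filter_mono nhdsWithin_le_nhds).mono fun t ht => ht.le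
  set a : ℝ := cF / L with ha
  have ha0 : 0 < a := by positivity
  have hBF0 : 0 ≤ BF := by
    obtain ⟨-, h0⟩ := hF 0 Matrix.PosSemidef.zero 0 le_rfl (by simpa using hcF.le)
    exact le_trans (integral_nonneg fun w => (Real.exp_pos _).le) h0
  refine ⟨BF / a, by positivity, ?_⟩
  filter_upwards [evL, self_mem_nhdsWithin] with t htL ht0
  set P := multivariateGaussian 0 (D.Cinf - D.C t) with hP
  have hPSD : (D.Cinf - D.C t).PosSemidef := D.posSemidef_Cinf_sub (mem_Ici.1 ht0)
  have haL : a * (∑ i, ∑ j, |(D.Cinf - D.C t) i j|) ≤ cF := by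
    calc a * (∑ i, ∑ j, |(D.Cinf - D.C t) i j|) ≤ a * L := mul_le_mul_of_nonneg_left htL ha0.le
      _ = cF := by rw [ha]; field_simp
  obtain ⟨hIexp, hexpB⟩ := hF (D.Cinf - D.C t) hPSD a ha0.le haL
  have h2i : Integrable (fun w : EuclideanSpace ℝ (Fin N) => ‖w‖ ^ 2) P :=
    (IsGaussian.memLp_id P 2 (by simp)).integrable_norm_pow (by norm_num)
  refine ⟨h2i, ?_⟩
  have hpt : ∀ w : EuclideanSpace ℝ (Fin N), ‖w‖ ^ 2 ≤ a⁻¹ * Real.exp (a * ‖w‖ ^ 2) := by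
    intro w
    have h := Real.add_one_le_exp (a * ‖w‖ ^ 2)
    rw [le_inv_mul_iff₀' ha0]
    nlinarith
  calc ∫ w, ‖w‖ ^ 2 ∂P ≤ ∫ w, a⁻¹ * Real.exp (a * ‖w‖ ^ 2) ∂P :=
        integral_mono h2i (hIexp.const_mul _) hpt
    _ = a⁻¹ * ∫ w, Real.exp (a * ‖w‖ ^ 2) ∂P := integral_const_mul _ _
    _ ≤ a⁻¹ * BF := mul_le_mul_of_nonneg_left hexpB (inv_nonneg.2 ha0.le)
    _ = BF / a := by rw [div_eq_inv_mul]

end Moments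

/-! ### The tempered principle -/

section General

variable (D : CovDecomposition N) {V₀ : EuclideanSpace ℝ (Fin N) → ℝ}

set_option maxHeartbeats 800000 in
/-- **Continuity of `t ↦ E_{ν_t}[G_t]` at `t = 0⁺`, tempered form**: let `V₀` be measurable and bounded
below, `G_t` measurable, `e^{−V₀}G₀` bounded, measurable and uniformly continuous.  If the weighted
integrands converge up to a tempered error, `|Z_t(y)G_t(y) − e^{−V₀(y)}G₀(y)| ≤ ε(1+‖y‖²)` for all `y`,
eventually as `t → 0⁺`, for every `ε > 0` (`Z_t(y) = E_{C_t}[e^{−V₀}(y+·)] = e^{−V_t(y)}`), then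
`E_{ν_t}[G_t] → E_{ν_0}[G₀]` ([BBD] proof of Theorem 3, the boundary values at `t = 0`, for `V₀` unbounded
above). [cite: BauerschmidtBodineauDagallier2023, Theorem 3 (proof)] -/
theorem tendsto_renormExpect_nhdsWithin_zero_tempered (hVm : Measurable V₀) {b : ℝ}
    (hb : ∀ φ, b ≤ V₀ φ)
    {G : ℝ → EuclideanSpace ℝ (Fin N) → ℝ} {G0 : EuclideanSpace ℝ (Fin N) → ℝ}
    (hGm : ∀ t, Measurable (G t)) (hK0m : Measurable fun y => Real.exp (-V₀ y) * G0 y)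
    (hK0u : UniformContinuous fun y => Real.exp (-V₀ y) * G0 y) {M : ℝ}
    (hK0b : ∀ y, |Real.exp (-V₀ y) * G0 y| ≤ M)
    (hKu : ∀ ε : ℝ, 0 < ε → ∀ᶠ t in 𝓝[Ici (0 : ℝ)] 0, ∀ y,
      |(∫ w, Real.exp (-V₀ (y + w)) ∂(multivariateGaussian 0 (D.C t))) * G t y -
        Real.exp (-V₀ y) * G0 y| ≤ ε * (1 + ‖y‖ ^ 2)) :
    Tendsto (fun t => renormExpect D V₀ t (G t)) (𝓝[Ici (0 : ℝ)] 0) (𝓝 (renormExpect D V₀ 0 G0)) := by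
  have hM0 : 0 ≤ M := (abs_nonneg _).trans (hK0b 0)
  obtain ⟨M₂, hM₂0, evM⟩ := eventually_integral_norm_sq_Cinf_sub_le D
  -- weak continuity of `P_{C_∞−C_t}` on `e^{−V₀}G₀`
  have hweak := tendsto_integral_gaussian_Cinf_sub_Ici D hK0m hK0b hK0u (t := 0) le_rfl 0
  simp only [zero_add] at hweak
  -- the expectation as an integral against `P_{C_∞−C_t}`
  unfold renormExpect
  simp only [renormPotential_zero]
  refine Tendsto.const_mul _ ?_
  rw [Metric.tendsto_nhds]
  intro ε hε
  have hε2 : 0 < ε / 2 := half_pos hε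
  set ε' : ℝ := ε / 2 / 2 / (1 + M₂) with hε'
  have hε'0 : 0 < ε' := by positivity
  filter_upwards [hKu ε' hε'0, Metric.tendsto_nhds.1 hweak (ε / 2) hε2, evM] with t ht1 ht2 ⟨h2i, h2b⟩
  rw [Real.dist_eq] at ht2 ⊢
  set Q : Measure (EuclideanSpace ℝ (Fin N)) := multivariateGaussian 0 (D.Cinf - D.C t) with hQ
  -- pointwise control of the integrand
  have hpt : ∀ ζ, |Real.exp (-renormPotential D V₀ t ζ) * G t ζ - Real.exp (-V₀ ζ) * G0 ζ| ≤
      ε' * (1 + ‖ζ‖ ^ 2) := fun ζ => by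
    rw [exp_neg_renormPotential D hVm hb t ζ]; exact ht1 ζ
  have hbd : Integrable (fun ζ : EuclideanSpace ℝ (Fin N) => ε' * (1 + ‖ζ‖ ^ 2)) Q :=
    ((integrable_const (1 : ℝ)).add h2i).const_mul ε'
  have hI0 : Integrable (fun ζ => Real.exp (-V₀ ζ) * G0 ζ) Q :=
    Integrable.of_bound hK0m.aestronglyMeasurable M
      (Eventually.of_forall fun ζ => by rw [Real.norm_eq_abs]; exact hK0b ζ)
  have hIt : Integrable (fun ζ => Real.exp (-renormPotential D V₀ t ζ) * G t ζ) Q := by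
    refine Integrable.mono' (hI0.norm.add hbd)
      (measurable_exp_neg_renormPotential_mul D hVm t (hGm t)).aestronglyMeasurable
      (Eventually.of_forall fun ζ => ?_)
    rw [Real.norm_eq_abs]
    have h1 := hpt ζ
    have h3 := abs_sub_abs_le_abs_sub (Real.exp (-renormPotential D V₀ t ζ) * G t ζ)
      (Real.exp (-V₀ ζ) * G0 ζ)
    simp only [Pi.add_apply, Real.norm_eq_abs]
    linarith
  have hA : |(∫ ζ, Real.exp (-renormPotential D V₀ t ζ) * G t ζ ∂Q) -
      ∫ ζ, Real.exp (-V₀ ζ) * G0 ζ ∂Q| ≤ ε / 2 / 2 := by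
    rw [← integral_sub hIt hI0]
    calc |∫ ζ, (Real.exp (-renormPotential D V₀ t ζ) * G t ζ - Real.exp (-V₀ ζ) * G0 ζ) ∂Q|
        ≤ ∫ ζ, |Real.exp (-renormPotential D V₀ t ζ) * G t ζ - Real.exp (-V₀ ζ) * G0 ζ| ∂Q :=
          abs_integral_le_integral_abs
      _ ≤ ∫ ζ, ε' * (1 + ‖ζ‖ ^ 2) ∂Q := integral_mono (hIt.sub hI0).abs hbd hpt
      _ = ε' * (1 + ∫ ζ, ‖ζ‖ ^ 2 ∂Q) := by
          rw [integral_const_mul, integral_add (integrable_const _) h2i, integral_const, probReal_univ,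
            one_smul]
      _ ≤ ε' * (1 + M₂) := mul_le_mul_of_nonneg_left (by linarith) hε'0.le
      _ = ε / 2 / 2 := by rw [hε']; field_simp
  have htri := abs_sub_le
    (∫ ζ, Real.exp (-renormPotential D V₀ t ζ) * G t ζ ∂Q)
    (∫ ζ, Real.exp (-V₀ ζ) * G0 ζ ∂Q)
    (∫ ζ, Real.exp (-V₀ ζ) * G0 ζ ∂(multivariateGaussian 0 (D.Cinf - D.C 0)))
  linarith

end General

/-! ### From local uniform convergence to the tempered hypothesis -/

section Local

variable {Ψ : EuclideanSpace ℝ (Fin N) → ℝ} {c₁ c₂ : ℝ}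

/-- The far region: if `Ψ ≥ c₁e^{−c₂‖x‖²}` and `Ψ(y) < c₁e^{−c₂R}` then `‖y‖² > R`. [folklore] -/
private theorem lt_normSq_of_lt_threshold (hc₁ : 0 < c₁) (hc₂ : 0 ≤ c₂)
    (hlow : ∀ x, c₁ * Real.exp (-(c₂ * ‖x‖ ^ 2)) ≤ Ψ x) {R : ℝ} {y : EuclideanSpace ℝ (Fin N)}
    (hy : Ψ y < c₁ * Real.exp (-(c₂ * R))) : R < ‖y‖ ^ 2 := by
  have h1 : c₁ * Real.exp (-(c₂ * ‖y‖ ^ 2)) < c₁ * Real.exp (-(c₂ * R)) := (hlow y).trans_lt hy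
  have h2 := lt_of_mul_lt_mul_left h1 hc₁.le
  rw [Real.exp_lt_exp] at h2
  by_contra hcon
  push Not at hcon
  have h3 := mul_le_mul_of_nonneg_left hcon hc₂
  linarith

/-- **Local uniform convergence + a uniform bound + the Gaussian lower bound ⟹ tempered convergence**:
if `|d_t| ≤ M_d` and, for every `η > 0`, `d_t → 0` uniformly on `{Ψ ≥ η}`, then for every `ε > 0`
eventually `|d_t(y)| ≤ ε(1+‖y‖²)` for all `y` (off `{Ψ ≥ η}` one has `‖y‖² > R` with `η = c₁e^{−c₂R}`).
[cite: BauerschmidtBodineauDagallier2023, Theorem 3 (proof)] -/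
theorem tempered_of_local (hc₁ : 0 < c₁) (hc₂ : 0 ≤ c₂)
    (hlow : ∀ x, c₁ * Real.exp (-(c₂ * ‖x‖ ^ 2)) ≤ Ψ x) {l : Filter ℝ}
    {d : ℝ → EuclideanSpace ℝ (Fin N) → ℝ} {Md : ℝ} (hMd : ∀ᶠ t in l, ∀ y, |d t y| ≤ Md)
    (hloc : ∀ η : ℝ, 0 < η → ∀ ε : ℝ, 0 < ε → ∀ᶠ t in l, ∀ y, η ≤ Ψ y → |d t y| ≤ ε) :
    ∀ ε : ℝ, 0 < ε → ∀ᶠ t in l, ∀ y, |d t y| ≤ ε * (1 + ‖y‖ ^ 2) := by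
  intro ε hε
  set R : ℝ := |Md| / ε with hR
  set η : ℝ := c₁ * Real.exp (-(c₂ * R)) with hη
  have hη0 : 0 < η := by positivity
  filter_upwards [hMd, hloc η hη0 ε hε] with t h1 h2 y
  by_cases hy : η ≤ Ψ y
  · calc |d t y| ≤ ε := h2 y hy
      _ = ε * 1 := (mul_one ε).symm
      _ ≤ ε * (1 + ‖y‖ ^ 2) := mul_le_mul_of_nonneg_left (by nlinarith [sq_nonneg ‖y‖]) hε.le
  · push Not at hy
    have hRy : R < ‖y‖ ^ 2 := lt_normSq_of_lt_threshold hc₁ hc₂ hlow hy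
    calc |d t y| ≤ Md := h1 y
      _ ≤ |Md| := le_abs_self _
      _ = ε * R := by rw [hR]; field_simp
      _ ≤ ε * (1 + ‖y‖ ^ 2) := mul_le_mul_of_nonneg_left (by linarith) hε.le

end Local

/-! ### The two instances for the smoothed class -/

section Instances

variable (D : CovDecomposition N) {Ψ V₀ F : EuclideanSpace ℝ (Fin N) → ℝ} {B BF a b c₁ c₂ : ℝ}

set_option maxHeartbeats 1600000 in
/-- **`E_{ν_t}[Φ(P_{0,t}F)] → ∫ Φ(F) dν₀` as `t → 0⁺`, smoothed class** (`ν_0 = ν₀`, `P_{0,0} = id`;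
[BBD] proof of Theorem 3, the value `Ent` is attained at `t = 0`), for `e^{−V₀} = Ψ ∈ C⁴` positive with
bounded derivatives and a Gaussian lower bound, `F ∈ C_b⁴` with `0 < a ≤ F ≤ b`, and `Φ` bounded and
uniformly continuous. [cite: BauerschmidtBodineauDagallier2023, Theorem 3 (proof)] -/
theorem tendsto_renormExpect_comp_semigroup_zero_smoothed
    (hΨ : ContDiff ℝ 4 Ψ) (hB : ∀ n ≤ 4, ∀ x, ‖iteratedFDeriv ℝ n Ψ x‖ ≤ B) (hpos : ∀ x, 0 < Ψ x)
    (hc₁ : 0 < c₁) (hc₂ : 0 ≤ c₂) (hlow : ∀ x, c₁ * Real.exp (-(c₂ * ‖x‖ ^ 2)) ≤ Ψ x)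
    (hΨV : ∀ x, Real.exp (-V₀ x) = Ψ x)
    (hF : ContDiff ℝ 4 F) (hFB : ∀ n ≤ 4, ∀ x, ‖iteratedFDeriv ℝ n F x‖ ≤ BF)
    (ha : 0 < a) (hab : ∀ x, a ≤ F x ∧ F x ≤ b)
    {Φ : ℝ → ℝ} (hΦu : UniformContinuous Φ) {P0 : ℝ} (hP0 : ∀ x, |Φ x| ≤ P0) :
    Tendsto (fun t => renormExpect D V₀ t fun y => Φ (semigroup D V₀ 0 t F y)) (𝓝[Ici (0 : ℝ)] 0)
      (𝓝 (∫ φ, Φ (F φ) ∂(nu0 D V₀))) := by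
  ---------------------------------------------------------------- data
  obtain ⟨x0⟩ : Nonempty (EuclideanSpace ℝ (Fin N)) := ⟨0⟩
  have hΨc : Continuous Ψ := hΨ.continuous
  have hΨabs : ∀ x, |Ψ x| ≤ B := Cb4.abs_le hB
  have hΨB : ∀ x, Ψ x ≤ B := fun x => (le_abs_self _).trans (hΨabs x)
  have hBpos : 0 < B := (hpos x0).trans_le (hΨB x0)
  have hV0 : ∀ x, V₀ x = -Real.log (Ψ x) := fun x => by
    have h := congrArg Real.log (hΨV x)
    rw [Real.log_exp] at h
    linarith
  have hVm : Measurable V₀ := by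
    have he : V₀ = fun x => -Real.log (Ψ x) := funext hV0
    rw [he]
    exact (Real.measurable_log.comp hΨc.measurable).neg
  have hb : ∀ φ, -Real.log B ≤ V₀ φ := fun φ => by
    rw [hV0]
    exact neg_le_neg (Real.log_le_log (hpos φ) (hΨB φ))
  have hFc : Continuous F := hF.continuous
  have hab' : a ≤ b := (hab x0).1.trans (hab x0).2
  have hb0 : 0 ≤ b := ha.le.trans hab'
  have hP00 : 0 ≤ P0 := (abs_nonneg _).trans (hP0 0)
  obtain ⟨hΨF, hBΨF⟩ := Cb4.mul hΨ hF hB hFB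
  have hΨu : UniformContinuous Ψ := (atom_uniformContinuous hΨ hB).1
  have hΨFu : UniformContinuous fun x => Ψ x * F x := (atom_uniformContinuous hΨF hBΨF).1
  have hFu : UniformContinuous F := (atom_uniformContinuous hF hFB).1
  haveI : ∀ s, IsProbabilityMeasure (multivariateGaussian 0 (D.C s)) := fun s => inferInstance
  have hZpos : ∀ s y, 0 < ∫ ζ, Ψ (y + ζ) ∂(multivariateGaussian 0 (D.C s)) :=
    fun s y => smZ_pos hΨc hpos hΨB _ y
  have hZabs : ∀ s y, |∫ ζ, Ψ (y + ζ) ∂(multivariateGaussian 0 (D.C s))| ≤ B :=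
    fun s y => (sm_pack hΨ hB (multivariateGaussian 0 (D.C s))).2.2.1 y
  have hWmem := fun s y => smW_mem hΨc hpos hΨB hFc hab (multivariateGaussian 0 (D.C s)) y
  have hWabs : ∀ s y, |∫ ζ, Ψ (y + ζ) * F (y + ζ) ∂(multivariateGaussian 0 (D.C s))| ≤ 16 * B * BF :=
    fun s y => (sm_pack hΨF hBΨF (multivariateGaussian 0 (D.C s))).2.2.1 y
  have hsemi : ∀ s y, semigroup D V₀ 0 s F y =
      (∫ ζ, Ψ (y + ζ) * F (y + ζ) ∂(multivariateGaussian 0 (D.C s))) *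
        (∫ ζ, Ψ (y + ζ) ∂(multivariateGaussian 0 (D.C s)))⁻¹ := fun s y => by
    rw [semigroup_zero_eq, exp_renormPotential_eq_inv D hVm hb, mul_comm]
    simp only [hΨV]
  have hub : ∀ s y, |(∫ ζ, Ψ (y + ζ) * F (y + ζ) ∂(multivariateGaussian 0 (D.C s))) *
      (∫ ζ, Ψ (y + ζ) ∂(multivariateGaussian 0 (D.C s)))⁻¹| ≤ b := fun s y => by
    have hu : a ≤ (∫ ζ, Ψ (y + ζ) * F (y + ζ) ∂(multivariateGaussian 0 (D.C s))) *
        (∫ ζ, Ψ (y + ζ) ∂(multivariateGaussian 0 (D.C s)))⁻¹ ∧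
        (∫ ζ, Ψ (y + ζ) * F (y + ζ) ∂(multivariateGaussian 0 (D.C s))) *
        (∫ ζ, Ψ (y + ζ) ∂(multivariateGaussian 0 (D.C s)))⁻¹ ≤ b := by
      rw [← div_eq_mul_inv, le_div_iff₀ (hZpos s y), div_le_iff₀ (hZpos s y)]; exact hWmem s y
    rw [abs_of_pos (ha.trans_le hu.1)]; exact hu.2
  ---------------------------------------------------------------- uniform convergence of the atoms
  have uZ := unif_integral_shift D hΨc.measurable hΨabs hΨu
  have uW := unif_integral_shift D (hΨF.continuous.measurable) (Cb4.abs_le hBΨF) hΨFu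
  ---------------------------------------------------------------- local uniform convergence of the weighted family
  have hloc : ∀ η : ℝ, 0 < η → ∀ ε : ℝ, 0 < ε → ∀ᶠ t in 𝓝[Ici (0 : ℝ)] 0, ∀ y, η ≤ Ψ y →
      |((∫ ζ, Ψ (y + ζ) ∂(multivariateGaussian 0 (D.C t))) *
          Φ ((∫ ζ, Ψ (y + ζ) * F (y + ζ) ∂(multivariateGaussian 0 (D.C t))) *
            (∫ ζ, Ψ (y + ζ) ∂(multivariateGaussian 0 (D.C t)))⁻¹) -
        Ψ y * Φ (F y))| ≤ ε := by
    intro η hη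
    have hη2 : 0 < η / 2 := half_pos hη
    have uZα := unifE_restrict (l := 𝓝[Ici (0 : ℝ)] 0) (fun y => η ≤ Ψ y) uZ
    have uWα := unifE_restrict (l := 𝓝[Ici (0 : ℝ)] 0) (fun y => η ≤ Ψ y) uW
    have bZα : ∀ᶠ t in 𝓝[Ici (0 : ℝ)] 0, ∀ y : {y : EuclideanSpace ℝ (Fin N) // η ≤ Ψ y},
        η / 2 ≤ ∫ ζ, Ψ (y.1 + ζ) ∂(multivariateGaussian 0 (D.C t)) := by
      filter_upwards [uZ (η / 2) hη2] with t ht y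
      have h := (abs_le.1 (ht y.1)).1
      have h2 := y.2
      linarith
    have bZ0α : ∀ y : {y : EuclideanSpace ℝ (Fin N) // η ≤ Ψ y}, η / 2 ≤ Ψ y.1 := fun y => by
      have h2 := y.2; linarith
    have uIZα := unifE_inv uZα hη2 bZα bZ0α
    have bIΨ : ∀ y : {y : EuclideanSpace ℝ (Fin N) // η ≤ Ψ y}, |(Ψ y.1)⁻¹| ≤ (η / 2)⁻¹ := fun y => by
      rw [abs_inv, abs_of_pos (hpos _)]; exact inv_anti₀ hη2 (bZ0α y)
    have uuα := unifE_mul uWα uIZα (KA := 16 * B * BF) (Eventually.of_forall fun t y => hWabs t y.1)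
      bIΨ
    have uuα' : ∀ ε : ℝ, 0 < ε → ∀ᶠ t in 𝓝[Ici (0 : ℝ)] 0,
        ∀ y : {y : EuclideanSpace ℝ (Fin N) // η ≤ Ψ y},
        |(∫ ζ, Ψ (y.1 + ζ) * F (y.1 + ζ) ∂(multivariateGaussian 0 (D.C t))) *
            (∫ ζ, Ψ (y.1 + ζ) ∂(multivariateGaussian 0 (D.C t)))⁻¹ - F y.1| ≤ ε := by
      intro ε hε
      filter_upwards [uuα ε hε] with t ht y
      have h := ht y
      have hΨne : Ψ y.1 ≠ 0 := (hpos _).ne'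
      rwa [show Ψ y.1 * F y.1 * (Ψ y.1)⁻¹ = F y.1 by field_simp] at h
    have uΦα := unifE_comp hΦu uuα'
    have uKα := unifE_mul uZα uΦα (KA := B) (Eventually.of_forall fun t y => hZabs t y.1) (KB := P0)
      (fun y => hP0 _)
    intro ε hε
    exact (uKα ε hε).mono fun t h y hy => h ⟨y, hy⟩
  ---------------------------------------------------------------- tempered convergence
  have hMd : ∀ᶠ t in 𝓝[Ici (0 : ℝ)] 0, ∀ y,
      |((∫ ζ, Ψ (y + ζ) ∂(multivariateGaussian 0 (D.C t))) *
          Φ ((∫ ζ, Ψ (y + ζ) * F (y + ζ) ∂(multivariateGaussian 0 (D.C t))) *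
            (∫ ζ, Ψ (y + ζ) ∂(multivariateGaussian 0 (D.C t)))⁻¹) -
        Ψ y * Φ (F y))| ≤ B * P0 + B * P0 := Eventually.of_forall fun t y => by
    refine (abs_sub _ _).trans (add_le_add ?_ ?_)
    · rw [abs_mul]; exact mul_le_mul (hZabs t y) (hP0 _) (abs_nonneg _) hBpos.le
    · rw [abs_mul]; exact mul_le_mul (hΨabs y) (hP0 _) (abs_nonneg _) hBpos.le
  have hT := tempered_of_local hc₁ hc₂ hlow hMd hloc
  ---------------------------------------------------------------- the tempered principle
  have hcu : ∀ t, Continuous (semigroup D V₀ 0 t F) := fun t => by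
    have he : semigroup D V₀ 0 t F = fun y =>
        (∫ ζ, Ψ (y + ζ) * F (y + ζ) ∂(multivariateGaussian 0 (D.C t))) *
          (∫ ζ, Ψ (y + ζ) ∂(multivariateGaussian 0 (D.C t)))⁻¹ := funext (hsemi t)
    rw [he]
    exact (continuous_iff_continuousAt.2 fun y =>
        ((sm_pack hΨF hBΨF (multivariateGaussian 0 (D.C t))).1 y).continuousAt).mul
      ((continuous_iff_continuousAt.2 fun y =>
        ((sm_pack hΨ hB (multivariateGaussian 0 (D.C t))).1 y).continuousAt).inv₀
        fun y => (hZpos t y).ne')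
  have hK0e : (fun y => Real.exp (-V₀ y) * Φ (F y)) = fun y => Ψ y * Φ (F y) := by
    funext y; rw [hΨV]
  have hK0m : Measurable fun y => Real.exp (-V₀ y) * Φ (F y) := by
    rw [hK0e]; exact (hΨc.mul (hΦu.continuous.comp hFc)).measurable
  have hK0u : UniformContinuous fun y => Real.exp (-V₀ y) * Φ (F y) := by
    rw [hK0e]; exact uc_mul hΨu (hΦu.comp hFu) hΨabs fun y => hP0 _
  have hK0b : ∀ y, |Real.exp (-V₀ y) * Φ (F y)| ≤ B * P0 := fun y => by
    rw [hΨV, abs_mul]; exact mul_le_mul (hΨabs y) (hP0 _) (abs_nonneg _) hBpos.le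
  have h := tendsto_renormExpect_nhdsWithin_zero_tempered D hVm hb
    (G := fun t y => Φ (semigroup D V₀ 0 t F y)) (G0 := fun y => Φ (F y))
    (fun t => (hΦu.continuous.comp (hcu t)).measurable) hK0m hK0u hK0b
    (fun ε hε => by
      filter_upwards [hT ε hε] with t ht y
      have h1 := ht y
      simp only [hΨV, hsemi]
      exact h1)
  rwa [renormExpect_zero D hVm hb] at h

/-- A bounded continuous shift `ζ ↦ H(y+ζ)` is integrable for a finite measure. [folklore] -/
private theorem integrable_shift₄ {Y : Type*} [NormedAddCommGroup Y] {H : EuclideanSpace ℝ (Fin N) → Y}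
    (hHc : Continuous H) {MH : ℝ} (hH : ∀ x, ‖H x‖ ≤ MH) (P : Measure (EuclideanSpace ℝ (Fin N)))
    [IsFiniteMeasure P] (y : EuclideanSpace ℝ (Fin N)) : Integrable (fun ζ => H (y + ζ)) P :=
  Integrable.of_bound (hHc.comp (continuous_const.add continuous_id)).aestronglyMeasurable MH
    (Eventually.of_forall fun ζ => hH (y + ζ))

/-- Data of a `C_b⁴` integrand's partial `x ↦ ∂_kΨ(x)`: measurable, bounded by `B`, uniformly continuous.
[cite: BauerschmidtBodineauDagallier2023, Theorem 3 (proof)] -/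
private theorem partial_data' {Ψ : EuclideanSpace ℝ (Fin N) → ℝ} {B : ℝ} (hΨ : ContDiff ℝ 4 Ψ)
    (hB : ∀ n ≤ 4, ∀ x, ‖iteratedFDeriv ℝ n Ψ x‖ ≤ B) (k : Fin N) :
    Measurable (fun x => fderiv ℝ Ψ x (EuclideanSpace.single k 1)) ∧
    (∀ x, |fderiv ℝ Ψ x (EuclideanSpace.single k 1)| ≤ B) ∧
    UniformContinuous (fun x => fderiv ℝ Ψ x (EuclideanSpace.single k 1)) := by
  refine ⟨((ContinuousLinearMap.apply ℝ ℝ (EuclideanSpace.single k 1)).continuous.comp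
      (atom_continuous hΨ hB).2.1).measurable, fun x => ?_,
    (ContinuousLinearMap.apply ℝ ℝ (EuclideanSpace.single k 1)).uniformContinuous.comp
      (atom_uniformContinuous hΨ hB).2⟩
  have h := Cb4.abs_partial_le hB (EuclideanSpace.single k 1) x
  rwa [Cb4.norm_single_one, mul_one] at h

/-- A `P`-uniform tame bound of the first partial atoms from the domination hypothesis:
`|E_P[∂_kG(y+·)]| ≤ c_δ (E_P[Ψ(y+·)])^{1−δ}`. [cite: BauerschmidtBodineauDagallier2023, Proposition 8 (proof)] -/
private theorem partial_atom_tame {Ψ G : EuclideanSpace ℝ (Fin N) → ℝ} {BG : ℝ} (hG : ContDiff ℝ 4 G)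
    (hBG : ∀ n ≤ 4, ∀ x, ‖iteratedFDeriv ℝ n G x‖ ≤ BG)
    (hwG : ∀ n ≤ 4, ∀ δ : ℝ, 0 < δ → ∃ c : ℝ, 0 ≤ c ∧
      ∀ (P : Measure (EuclideanSpace ℝ (Fin N))) [IsProbabilityMeasure P] (y : EuclideanSpace ℝ (Fin N)),
        ∫ ζ, ‖iteratedFDeriv ℝ n G (y + ζ)‖ ∂P ≤ c * (∫ ζ, Ψ (y + ζ) ∂P) ^ (1 - δ))
    {δ : ℝ} (hδ : 0 < δ) :
    ∃ c : ℝ, 0 ≤ c ∧ ∀ (P : Measure (EuclideanSpace ℝ (Fin N))) [IsProbabilityMeasure P] (k : Fin N)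
      (y : EuclideanSpace ℝ (Fin N)),
      |∫ ζ, fderiv ℝ G (y + ζ) (EuclideanSpace.single k 1) ∂P| ≤ c * (∫ ζ, Ψ (y + ζ) ∂P) ^ (1 - δ) := by
  obtain ⟨c, hc0, hc⟩ := hwG 1 (by norm_num) δ hδ
  refine ⟨c, hc0, fun P _ k y => ?_⟩
  rw [← Real.norm_eq_abs]
  refine (norm_integral_le_of_norm_le ((integrable_shift₄ (hG.continuous_iteratedFDeriv
    (by norm_num)) (hBG 1 (by norm_num)) P y).norm) (Eventually.of_forall fun ζ => ?_)).trans (hc P y)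
  rw [Real.norm_eq_abs, ← Cb4.norm_fderiv_eq_norm_iteratedFDeriv_one]
  calc |fderiv ℝ G (y + ζ) (EuclideanSpace.single k 1)|
      ≤ ‖fderiv ℝ G (y + ζ)‖ * ‖(EuclideanSpace.single k (1 : ℝ))‖ := by
        rw [← Real.norm_eq_abs]; exact ContinuousLinearMap.le_opNorm _ _
    _ = ‖fderiv ℝ G (y + ζ)‖ := by rw [Cb4.norm_single_one, mul_one]

set_option maxHeartbeats 4000000 in
/-- **`E_{ν_t}[(∇√P_{0,t}F)²_{Ċ_t}] → ∫ Σ Ċ_0^{kl}∂_kF∂_lF/(4F) dν₀` as `t → 0⁺`, smoothed class**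
([BBD] proof of Theorem 3: the right-hand side of (e:LSI) is the value at `t = 0`), for `e^{−V₀} = Ψ ∈ C⁴`
positive with bounded, `Ψ`-dominated derivatives and a Gaussian lower bound, and `F ∈ C_b⁴` with
`0 < a ≤ F ≤ b` (`Ċ` read at `t ∨ 0`).  The weighted integrand `Z_t(∇√P_{0,t}F)²_{Ċ_t}` is bounded
(domination) and converges uniformly on every `{Ψ ≥ η}`. [cite: BauerschmidtBodineauDagallier2023, Theorem 3 (proof)] -/
theorem tendsto_renormExpect_sqrtEnergy_zero_smoothed
    (hΨ : ContDiff ℝ 4 Ψ) (hB : ∀ n ≤ 4, ∀ x, ‖iteratedFDeriv ℝ n Ψ x‖ ≤ B) (hpos : ∀ x, 0 < Ψ x)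
    (hw : ∀ n ≤ 4, ∀ δ : ℝ, 0 < δ → ∃ c : ℝ, 0 ≤ c ∧
      ∀ (P : Measure (EuclideanSpace ℝ (Fin N))) [IsProbabilityMeasure P] (y : EuclideanSpace ℝ (Fin N)),
        ∫ ζ, ‖iteratedFDeriv ℝ n Ψ (y + ζ)‖ ∂P ≤ c * (∫ ζ, Ψ (y + ζ) ∂P) ^ (1 - δ))
    (hc₁ : 0 < c₁) (hc₂ : 0 ≤ c₂) (hlow : ∀ x, c₁ * Real.exp (-(c₂ * ‖x‖ ^ 2)) ≤ Ψ x)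
    (hΨV : ∀ x, Real.exp (-V₀ x) = Ψ x)
    (hF : ContDiff ℝ 4 F) (hFB : ∀ n ≤ 4, ∀ x, ‖iteratedFDeriv ℝ n F x‖ ≤ BF)
    (ha : 0 < a) (hab : ∀ x, a ≤ F x ∧ F x ≤ b) :
    Tendsto (fun t => renormExpect D V₀ t fun y =>
        (1 / 4) * ((∑ k, ∑ l, D.Cdot (max t 0) k l *
          (fderiv ℝ (semigroup D V₀ 0 t F) y (EuclideanSpace.single k 1) *
            fderiv ℝ (semigroup D V₀ 0 t F) y (EuclideanSpace.single l 1))) *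
          (semigroup D V₀ 0 t F y)⁻¹)) (𝓝[Ici (0 : ℝ)] 0)
      (𝓝 (∫ φ, (1 / 4) * ((∑ k, ∑ l, D.Cdot 0 k l *
          (fderiv ℝ F φ (EuclideanSpace.single k 1) * fderiv ℝ F φ (EuclideanSpace.single l 1))) *
          (F φ)⁻¹) ∂(nu0 D V₀))) := by
  classical
  ---------------------------------------------------------------- data
  obtain ⟨x0⟩ : Nonempty (EuclideanSpace ℝ (Fin N)) := ⟨0⟩
  have hΨ0 : ∀ x, 0 ≤ Ψ x := fun x => (hpos x).le
  have hΨc : Continuous Ψ := hΨ.continuous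
  have hΨabs : ∀ x, |Ψ x| ≤ B := Cb4.abs_le hB
  have hΨB : ∀ x, Ψ x ≤ B := fun x => (le_abs_self _).trans (hΨabs x)
  have hBpos : 0 < B := (hpos x0).trans_le (hΨB x0)
  have hV0 : ∀ x, V₀ x = -Real.log (Ψ x) := fun x => by
    have h := congrArg Real.log (hΨV x)
    rw [Real.log_exp] at h
    linarith
  have hVm : Measurable V₀ := by
    have he : V₀ = fun x => -Real.log (Ψ x) := funext hV0
    rw [he]
    exact (Real.measurable_log.comp hΨc.measurable).neg
  have hb : ∀ φ, -Real.log B ≤ V₀ φ := fun φ => by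
    rw [hV0]
    exact neg_le_neg (Real.log_le_log (hpos φ) (hΨB φ))
  have hFc : Continuous F := hF.continuous
  have hab' : a ≤ b := (hab x0).1.trans (hab x0).2
  have hb0 : 0 ≤ b := ha.le.trans hab'
  have hBF0 : 0 ≤ BF := le_trans (norm_nonneg _) (hFB 0 (by norm_num) x0)
  obtain ⟨hΨF, hBΨF, hwΨF⟩ := dominated_mul (M := 4) hΨ0 hΨ hB hw hF hFB
  have hΨu : UniformContinuous Ψ := (atom_uniformContinuous hΨ hB).1
  have hΨFu : UniformContinuous fun x => Ψ x * F x := (atom_uniformContinuous hΨF hBΨF).1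
  have hFu : UniformContinuous F := (atom_uniformContinuous hF hFB).1
  have haF : ∀ x, a ≤ F x := fun x => (hab x).1
  have hK16 : (0 : ℝ) ≤ 2 ^ 4 * B * BF := by positivity
  obtain ⟨KC, hKC⟩ := D.bounded_Cdot
  haveI : ∀ s, IsProbabilityMeasure (multivariateGaussian 0 (D.C s)) := fun s => inferInstance
  have hZpos : ∀ s y, 0 < ∫ ζ, Ψ (y + ζ) ∂(multivariateGaussian 0 (D.C s)) :=
    fun s y => smZ_pos hΨc hpos hΨB _ y
  have hZle : ∀ s y, ∫ ζ, Ψ (y + ζ) ∂(multivariateGaussian 0 (D.C s)) ≤ B :=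
    fun s y => smZ_le hΨc hpos hΨB _ y
  have hZabs : ∀ s y, |∫ ζ, Ψ (y + ζ) ∂(multivariateGaussian 0 (D.C s))| ≤ B :=
    fun s y => (sm_pack hΨ hB (multivariateGaussian 0 (D.C s))).2.2.1 y
  have hWmem := fun s y => smW_mem hΨc hpos hΨB hFc hab (multivariateGaussian 0 (D.C s)) y
  have hWabs : ∀ s y, |∫ ζ, Ψ (y + ζ) * F (y + ζ) ∂(multivariateGaussian 0 (D.C s))| ≤ 2 ^ 4 * B * BF :=
    fun s y => (sm_pack hΨF hBΨF (multivariateGaussian 0 (D.C s))).2.2.1 y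
  have hsemi : ∀ s y, semigroup D V₀ 0 s F y =
      (∫ ζ, Ψ (y + ζ) * F (y + ζ) ∂(multivariateGaussian 0 (D.C s))) *
        (∫ ζ, Ψ (y + ζ) ∂(multivariateGaussian 0 (D.C s)))⁻¹ := fun s y => by
    rw [semigroup_zero_eq, exp_renormPotential_eq_inv D hVm hb, mul_comm]
    simp only [hΨV]
  have hau : ∀ s y, a ≤ (∫ ζ, Ψ (y + ζ) * F (y + ζ) ∂(multivariateGaussian 0 (D.C s))) *
      (∫ ζ, Ψ (y + ζ) ∂(multivariateGaussian 0 (D.C s)))⁻¹ := fun s y => by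
    rw [← div_eq_mul_inv, le_div_iff₀ (hZpos s y)]; exact (hWmem s y).1
  have hub : ∀ s y, (∫ ζ, Ψ (y + ζ) * F (y + ζ) ∂(multivariateGaussian 0 (D.C s))) *
      (∫ ζ, Ψ (y + ζ) ∂(multivariateGaussian 0 (D.C s)))⁻¹ ≤ b := fun s y => by
    rw [← div_eq_mul_inv, div_le_iff₀ (hZpos s y)]; exact (hWmem s y).2
  -- evaluation identities and sup bounds of the partial atoms
  have hZ1 : ∀ s (k : Fin N) x, (∫ ζ, fderiv ℝ Ψ (x + ζ) ∂(multivariateGaussian 0 (D.C s)))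
      (EuclideanSpace.single k 1) =
      ∫ ζ, fderiv ℝ Ψ (x + ζ) (EuclideanSpace.single k 1) ∂(multivariateGaussian 0 (D.C s)) :=
    fun s k x => sm_fderiv_apply hΨ hB _ x _
  have hW1 : ∀ s (k : Fin N) x, (∫ ζ, fderiv ℝ (fun x => Ψ x * F x) (x + ζ)
      ∂(multivariateGaussian 0 (D.C s))) (EuclideanSpace.single k 1) =
      ∫ ζ, fderiv ℝ (fun x => Ψ x * F x) (x + ζ) (EuclideanSpace.single k 1)
        ∂(multivariateGaussian 0 (D.C s)) :=
    fun s k x => sm_fderiv_apply hΨF hBΨF _ x _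
  have bZ1 : ∀ s (k : Fin N) y, |∫ ζ, fderiv ℝ Ψ (y + ζ) (EuclideanSpace.single k 1)
      ∂(multivariateGaussian 0 (D.C s))| ≤ B := fun s k y => by
    have h := sm_partial_abs_le hB (multivariateGaussian 0 (D.C s)) (EuclideanSpace.single k 1) y
    rwa [Cb4.norm_single_one, mul_one] at h
  have bW1 : ∀ s (k : Fin N) y, |∫ ζ, fderiv ℝ (fun x => Ψ x * F x) (y + ζ) (EuclideanSpace.single k 1)
      ∂(multivariateGaussian 0 (D.C s))| ≤ 2 ^ 4 * B * BF := fun s k y => by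
    have h := sm_partial_abs_le hBΨF (multivariateGaussian 0 (D.C s)) (EuclideanSpace.single k 1) y
    rwa [Cb4.norm_single_one, mul_one] at h
  have pdZ := fun k => partial_data' hΨ hB k
  have pdW := fun k => partial_data' hΨF hBΨF k
  have pdF := fun k => partial_data' hF hFB k
  -- `∂_k P_{0,s}F` in the atoms (quotient rule)
  have hgf : ∀ (k : Fin N) s y, fderiv ℝ (semigroup D V₀ 0 s F) y (EuclideanSpace.single k 1) =
      (∫ ζ, fderiv ℝ (fun x => Ψ x * F x) (y + ζ) (EuclideanSpace.single k 1)
          ∂(multivariateGaussian 0 (D.C s))) *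
        (∫ ζ, Ψ (y + ζ) ∂(multivariateGaussian 0 (D.C s)))⁻¹ -
      (∫ ζ, Ψ (y + ζ) * F (y + ζ) ∂(multivariateGaussian 0 (D.C s))) *
        ((∫ ζ, fderiv ℝ Ψ (y + ζ) (EuclideanSpace.single k 1) ∂(multivariateGaussian 0 (D.C s))) *
          ((∫ ζ, Ψ (y + ζ) ∂(multivariateGaussian 0 (D.C s)))⁻¹ *
            (∫ ζ, Ψ (y + ζ) ∂(multivariateGaussian 0 (D.C s)))⁻¹)) := by
    intro k s y
    have hsf : semigroup D V₀ 0 s F = fun y =>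
        (∫ ζ, Ψ (y + ζ) * F (y + ζ) ∂(multivariateGaussian 0 (D.C s))) *
          (∫ ζ, Ψ (y + ζ) ∂(multivariateGaussian 0 (D.C s)))⁻¹ := funext (hsemi s)
    obtain ⟨Du', D2u', pu', hDu', -⟩ := quotient_tjets (hZpos s)
      (sm_jpack (Ψ := Ψ) hΨ hB (multivariateGaussian 0 (D.C s)) hw)
      (sm_jpack (Ψ := Ψ) hΨF hBΨF (multivariateGaussian 0 (D.C s)) hwΨF) _ (fun _ => rfl)
    rw [hsf, (pu'.1 y).fderiv, hDu', hZ1 s, hW1 s]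
    ring
  ---------------------------------------------------------------- uniform convergence of the atoms
  have uZ := unif_integral_shift D hΨc.measurable hΨabs hΨu
  have uW := unif_integral_shift D hΨF.continuous.measurable (Cb4.abs_le hBΨF) hΨFu
  have uZ1 := fun k => unif_integral_shift D (pdZ k).1 (pdZ k).2.1 (pdZ k).2.2
  have uW1 := fun k => unif_integral_shift D (pdW k).1 (pdW k).2.1 (pdW k).2.2
  ---------------------------------------------------------------- the objects `g_{k,t}` in the atoms
  obtain ⟨GG, hGG⟩ : ∃ GG : Fin N → ℝ → EuclideanSpace ℝ (Fin N) → ℝ, GG = fun k s y =>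
    (∫ ζ, fderiv ℝ (fun x => Ψ x * F x) (y + ζ) (EuclideanSpace.single k 1)
        ∂(multivariateGaussian 0 (D.C s))) *
      (∫ ζ, Ψ (y + ζ) ∂(multivariateGaussian 0 (D.C s)))⁻¹ -
    (∫ ζ, Ψ (y + ζ) * F (y + ζ) ∂(multivariateGaussian 0 (D.C s))) *
      ((∫ ζ, fderiv ℝ Ψ (y + ζ) (EuclideanSpace.single k 1) ∂(multivariateGaussian 0 (D.C s))) *
        ((∫ ζ, Ψ (y + ζ) ∂(multivariateGaussian 0 (D.C s)))⁻¹ *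
          (∫ ζ, Ψ (y + ζ) ∂(multivariateGaussian 0 (D.C s)))⁻¹)) := ⟨_, rfl⟩
  ---------------------------------------------------------------- global bound of the weighted family
  obtain ⟨cZ1, hcZ10, bZ1h⟩ := partial_atom_tame (Ψ := Ψ) hΨ hB hw (δ := 1 / 2) (by norm_num)
  obtain ⟨cW1, hcW10, bW1h⟩ := partial_atom_tame (Ψ := Ψ) hΨF hBΨF hwΨF (δ := 1 / 2) (by norm_num)
  set cn : ℝ := cW1 + b * cZ1 with hcn
  have hcn0 : 0 ≤ cn := by positivity
  have bn : ∀ s (k : Fin N) y,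
      |(∫ ζ, fderiv ℝ (fun x => Ψ x * F x) (y + ζ) (EuclideanSpace.single k 1)
          ∂(multivariateGaussian 0 (D.C s))) -
        (∫ ζ, Ψ (y + ζ) * F (y + ζ) ∂(multivariateGaussian 0 (D.C s))) *
          (∫ ζ, Ψ (y + ζ) ∂(multivariateGaussian 0 (D.C s)))⁻¹ *
          ∫ ζ, fderiv ℝ Ψ (y + ζ) (EuclideanSpace.single k 1) ∂(multivariateGaussian 0 (D.C s))| ≤
      cn * (∫ ζ, Ψ (y + ζ) ∂(multivariateGaussian 0 (D.C s))) ^ (1 - 1 / 2 : ℝ) := by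
    intro s k y
    have hu0 : 0 ≤ (∫ ζ, Ψ (y + ζ) * F (y + ζ) ∂(multivariateGaussian 0 (D.C s))) *
        (∫ ζ, Ψ (y + ζ) ∂(multivariateGaussian 0 (D.C s)))⁻¹ := ha.le.trans (hau s y)
    calc _ ≤ |∫ ζ, fderiv ℝ (fun x => Ψ x * F x) (y + ζ) (EuclideanSpace.single k 1)
            ∂(multivariateGaussian 0 (D.C s))| +
          |(∫ ζ, Ψ (y + ζ) * F (y + ζ) ∂(multivariateGaussian 0 (D.C s))) *
            (∫ ζ, Ψ (y + ζ) ∂(multivariateGaussian 0 (D.C s)))⁻¹ *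
            ∫ ζ, fderiv ℝ Ψ (y + ζ) (EuclideanSpace.single k 1) ∂(multivariateGaussian 0 (D.C s))| :=
          abs_sub _ _
      _ ≤ cW1 * (∫ ζ, Ψ (y + ζ) ∂(multivariateGaussian 0 (D.C s))) ^ (1 - 1 / 2 : ℝ) +
          b * (cZ1 * (∫ ζ, Ψ (y + ζ) ∂(multivariateGaussian 0 (D.C s))) ^ (1 - 1 / 2 : ℝ)) := by
          refine add_le_add (bW1h _ k y) ?_
          rw [abs_mul, abs_of_nonneg hu0]
          exact mul_le_mul (hub s y) (bZ1h _ k y) (abs_nonneg _) hb0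
      _ = cn * (∫ ζ, Ψ (y + ζ) ∂(multivariateGaussian 0 (D.C s))) ^ (1 - 1 / 2 : ℝ) := by
          rw [hcn]; ring
  have bC' : ∀ (t : ℝ) k l, |D.Cdot (max t 0) k l| ≤ |KC| := fun t k l =>
    (hKC _ (le_max_right _ _) k l).trans (le_abs_self KC)
  set K0 : ℝ := (1 / 4) * (∑ _k : Fin N, ∑ _l : Fin N, |KC| * cn ^ 2) * a⁻¹ with hK0
  have hKb : ∀ s y, |(∫ ζ, Ψ (y + ζ) ∂(multivariateGaussian 0 (D.C s))) *
      ((1 / 4) * ((∑ k, ∑ l, D.Cdot (max s 0) k l * (GG k s y * GG l s y)) *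
        ((∫ ζ, Ψ (y + ζ) * F (y + ζ) ∂(multivariateGaussian 0 (D.C s))) *
          (∫ ζ, Ψ (y + ζ) ∂(multivariateGaussian 0 (D.C s)))⁻¹)⁻¹))| ≤ K0 := by
    intro s y
    set Zs : ℝ := ∫ ζ, Ψ (y + ζ) ∂(multivariateGaussian 0 (D.C s)) with hZs
    set Ws : ℝ := ∫ ζ, Ψ (y + ζ) * F (y + ζ) ∂(multivariateGaussian 0 (D.C s)) with hWs
    have hZs0 : 0 < Zs := hZpos s y
    have hus : a ≤ Ws * Zs⁻¹ := hau s y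
    have hus0 : 0 < Ws * Zs⁻¹ := ha.trans_le hus
    have hsq : Zs ^ (1 - 1 / 2 : ℝ) * Zs ^ (1 - 1 / 2 : ℝ) = Zs := by
      rw [← Real.rpow_add hZs0]; norm_num
    have hgg : ∀ k l : Fin N, |GG k s y * GG l s y| ≤ cn ^ 2 * Zs⁻¹ := by
      intro k l
      have ek : GG k s y = ((∫ ζ, fderiv ℝ (fun x => Ψ x * F x) (y + ζ) (EuclideanSpace.single k 1)
            ∂(multivariateGaussian 0 (D.C s))) -
          Ws * Zs⁻¹ * ∫ ζ, fderiv ℝ Ψ (y + ζ) (EuclideanSpace.single k 1)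
            ∂(multivariateGaussian 0 (D.C s))) * Zs⁻¹ := by
        simp only [hGG]; ring
      have el : GG l s y = ((∫ ζ, fderiv ℝ (fun x => Ψ x * F x) (y + ζ) (EuclideanSpace.single l 1)
            ∂(multivariateGaussian 0 (D.C s))) -
          Ws * Zs⁻¹ * ∫ ζ, fderiv ℝ Ψ (y + ζ) (EuclideanSpace.single l 1)
            ∂(multivariateGaussian 0 (D.C s))) * Zs⁻¹ := by
        simp only [hGG]; ring
      rw [ek, el, abs_mul, abs_mul, abs_mul, abs_of_pos (inv_pos.2 hZs0)]
      have hk := bn s k y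
      have hl := bn s l y
      have hZi : 0 ≤ Zs⁻¹ := (inv_pos.2 hZs0).le
      calc _ ≤ (cn * Zs ^ (1 - 1 / 2 : ℝ)) * Zs⁻¹ * ((cn * Zs ^ (1 - 1 / 2 : ℝ)) * Zs⁻¹) :=
            mul_le_mul (mul_le_mul_of_nonneg_right hk hZi) (mul_le_mul_of_nonneg_right hl hZi)
              (by positivity) (by positivity)
        _ = cn ^ 2 * (Zs ^ (1 - 1 / 2 : ℝ) * Zs ^ (1 - 1 / 2 : ℝ)) * Zs⁻¹ * Zs⁻¹ := by ring
        _ = cn ^ 2 * Zs⁻¹ := by rw [hsq]; field_simp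
    have hsum : |∑ k, ∑ l, D.Cdot (max s 0) k l * (GG k s y * GG l s y)| ≤
        (∑ _k : Fin N, ∑ _l : Fin N, |KC| * cn ^ 2) * Zs⁻¹ := by
      rw [Finset.sum_mul]
      refine (Finset.abs_sum_le_sum_abs _ _).trans (Finset.sum_le_sum fun k _ => ?_)
      rw [Finset.sum_mul]
      refine (Finset.abs_sum_le_sum_abs _ _).trans (Finset.sum_le_sum fun l _ => ?_)
      rw [abs_mul]
      calc |D.Cdot (max s 0) k l| * _ ≤ |KC| * (cn ^ 2 * Zs⁻¹) :=
            mul_le_mul (bC' s k l) (hgg k l) (abs_nonneg _) (abs_nonneg _)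
        _ = |KC| * cn ^ 2 * Zs⁻¹ := by ring
    rw [abs_mul, abs_of_pos hZs0, abs_mul, abs_of_pos (by norm_num : (0 : ℝ) < 1 / 4), abs_mul,
      abs_inv, abs_of_pos hus0]
    calc Zs * (1 / 4 * (|∑ k, ∑ l, D.Cdot (max s 0) k l * (GG k s y * GG l s y)| * (Ws * Zs⁻¹)⁻¹))
        ≤ Zs * (1 / 4 * (((∑ _k : Fin N, ∑ _l : Fin N, |KC| * cn ^ 2) * Zs⁻¹) * a⁻¹)) := by
          refine mul_le_mul_of_nonneg_left (mul_le_mul_of_nonneg_left ?_ (by norm_num)) hZs0.le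
          exact mul_le_mul hsum (inv_anti₀ ha hus) (inv_nonneg.2 hus0.le)
            (mul_nonneg (Finset.sum_nonneg fun _ _ => Finset.sum_nonneg fun _ _ => by positivity)
              (inv_nonneg.2 hZs0.le))
      _ = K0 := by rw [hK0]; field_simp
  ---------------------------------------------------------------- the limit objects
  have hC0 : ∀ k l, Tendsto (fun t : ℝ => D.Cdot (max t 0) k l) (𝓝[Ici (0 : ℝ)] 0) (𝓝 (D.Cdot 0 k l)) :=
    fun k l => tendsto_nhdsWithin_congr (f := fun t => D.Cdot t k l)
      (fun t ht => by rw [max_eq_left (mem_Ici.1 ht)])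
      (((D.hasDerivAt_Cdot 0 le_rfl k l).continuousAt.tendsto).mono_left nhdsWithin_le_nhds)
  have hdF : ∀ k, UniformContinuous (fun y => fderiv ℝ F y (EuclideanSpace.single k 1)) ∧
      ∀ y, |fderiv ℝ F y (EuclideanSpace.single k 1)| ≤ BF := fun k => ⟨(pdF k).2.2, (pdF k).2.1⟩
  have hIFu : UniformContinuous fun y => (F y)⁻¹ := uc_inv hFu ha haF
  have hIFb : ∀ y, |(F y)⁻¹| ≤ a⁻¹ := fun y => by
    rw [abs_inv, abs_of_pos (ha.trans_le (haF y))]; exact inv_anti₀ ha (haF y)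
  have hSu : UniformContinuous fun y => ∑ k, ∑ l, D.Cdot 0 k l *
      (fderiv ℝ F y (EuclideanSpace.single k 1) * fderiv ℝ F y (EuclideanSpace.single l 1)) :=
    uc_finset_sum Finset.univ _ fun k _ => uc_finset_sum Finset.univ _ fun l _ =>
      uc_mul uniformContinuous_const (uc_mul (hdF k).1 (hdF l).1 (hdF k).2 (hdF l).2)
        (fun _ => le_rfl) (B := BF * BF) fun y => by
          rw [abs_mul]; exact mul_le_mul ((hdF k).2 y) ((hdF l).2 y) (abs_nonneg _) hBF0
  have hSb : ∀ y, |∑ k, ∑ l, D.Cdot 0 k l *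
      (fderiv ℝ F y (EuclideanSpace.single k 1) * fderiv ℝ F y (EuclideanSpace.single l 1))| ≤
      ∑ k : Fin N, ∑ l : Fin N, |D.Cdot 0 k l| * (BF * BF) := fun y =>
    (Finset.abs_sum_le_sum_abs _ _).trans (Finset.sum_le_sum fun k _ =>
      (Finset.abs_sum_le_sum_abs _ _).trans (Finset.sum_le_sum fun l _ => by
        rw [abs_mul, abs_mul]
        exact mul_le_mul_of_nonneg_left (mul_le_mul ((hdF k).2 y) ((hdF l).2 y) (abs_nonneg _) hBF0)
          (abs_nonneg _)))
  have hG0u : UniformContinuous fun y => (1 / 4) * ((∑ k, ∑ l, D.Cdot 0 k l *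
      (fderiv ℝ F y (EuclideanSpace.single k 1) * fderiv ℝ F y (EuclideanSpace.single l 1))) *
      (F y)⁻¹) :=
    uc_mul uniformContinuous_const (uc_mul hSu hIFu hSb hIFb) (fun _ => le_rfl)
      (B := (∑ k : Fin N, ∑ l : Fin N, |D.Cdot 0 k l| * (BF * BF)) * a⁻¹) fun y => by
        rw [abs_mul]
        exact mul_le_mul (hSb y) (hIFb y) (abs_nonneg _) ((abs_nonneg _).trans (hSb y))
  have hG0b : ∀ y, |(1 / 4) * ((∑ k, ∑ l, D.Cdot 0 k l *
      (fderiv ℝ F y (EuclideanSpace.single k 1) * fderiv ℝ F y (EuclideanSpace.single l 1))) *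
      (F y)⁻¹)| ≤ |(1 / 4 : ℝ)| * ((∑ k : Fin N, ∑ l : Fin N, |D.Cdot 0 k l| * (BF * BF)) * a⁻¹) :=
    fun y => by
      rw [abs_mul, abs_mul]
      exact mul_le_mul_of_nonneg_left (mul_le_mul (hSb y) (hIFb y) (abs_nonneg _)
        ((abs_nonneg _).trans (hSb y))) (abs_nonneg _)
  -- the product rule at `t = 0`: `∂_k(ΨF)/Ψ − (ΨF)∂_kΨ/Ψ² = ∂_kF`
  have hprod : ∀ (k : Fin N) y, fderiv ℝ (fun x => Ψ x * F x) y (EuclideanSpace.single k 1) * (Ψ y)⁻¹ -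
      Ψ y * F y * (fderiv ℝ Ψ y (EuclideanSpace.single k 1) * ((Ψ y)⁻¹ * (Ψ y)⁻¹)) =
      fderiv ℝ F y (EuclideanSpace.single k 1) := by
    intro k y
    have hΨne : Ψ y ≠ 0 := (hpos y).ne'
    rw [fderiv_fun_mul ((hΨ.differentiable (by norm_num)).differentiableAt)
      ((hF.differentiable (by norm_num)).differentiableAt)]
    simp only [_root_.add_apply, _root_.smul_apply, smul_eq_mul]
    field_simp
    ring
  ---------------------------------------------------------------- local uniform convergence on `{Ψ ≥ η}`
  have hloc : ∀ η : ℝ, 0 < η → ∀ ε : ℝ, 0 < ε → ∀ᶠ t in 𝓝[Ici (0 : ℝ)] 0, ∀ y, η ≤ Ψ y →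
      |(∫ ζ, Ψ (y + ζ) ∂(multivariateGaussian 0 (D.C t))) *
          ((1 / 4) * ((∑ k, ∑ l, D.Cdot (max t 0) k l * (GG k t y * GG l t y)) *
            ((∫ ζ, Ψ (y + ζ) * F (y + ζ) ∂(multivariateGaussian 0 (D.C t))) *
              (∫ ζ, Ψ (y + ζ) ∂(multivariateGaussian 0 (D.C t)))⁻¹)⁻¹)) -
        Ψ y * ((1 / 4) * ((∑ k, ∑ l, D.Cdot 0 k l *
          (fderiv ℝ F y (EuclideanSpace.single k 1) * fderiv ℝ F y (EuclideanSpace.single l 1))) *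
          (F y)⁻¹))| ≤ ε := by
    intro η hη
    have hη2 : 0 < η / 2 := half_pos hη
    -- the region as a subtype
    have uZα := unifE_restrict (l := 𝓝[Ici (0 : ℝ)] 0) (fun y => η ≤ Ψ y) uZ
    have uWα := unifE_restrict (l := 𝓝[Ici (0 : ℝ)] 0) (fun y => η ≤ Ψ y) uW
    have uZ1α := fun k => unifE_restrict (l := 𝓝[Ici (0 : ℝ)] 0) (fun y => η ≤ Ψ y) (uZ1 k)
    have uW1α := fun k => unifE_restrict (l := 𝓝[Ici (0 : ℝ)] 0) (fun y => η ≤ Ψ y) (uW1 k)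
    have bZα : ∀ᶠ t in 𝓝[Ici (0 : ℝ)] 0, ∀ y : {y : EuclideanSpace ℝ (Fin N) // η ≤ Ψ y},
        η / 2 ≤ ∫ ζ, Ψ (y.1 + ζ) ∂(multivariateGaussian 0 (D.C t)) := by
      filter_upwards [uZ (η / 2) hη2] with t ht y
      have h := (abs_le.1 (ht y.1)).1
      have h2 := y.2
      linarith
    have bZ0α : ∀ y : {y : EuclideanSpace ℝ (Fin N) // η ≤ Ψ y}, η / 2 ≤ Ψ y.1 := fun y => by
      have h2 := y.2; linarith
    have uIZα := unifE_inv uZα hη2 bZα bZ0α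
    have bIZα : ∀ᶠ t in 𝓝[Ici (0 : ℝ)] 0, ∀ y : {y : EuclideanSpace ℝ (Fin N) // η ≤ Ψ y},
        |(∫ ζ, Ψ (y.1 + ζ) ∂(multivariateGaussian 0 (D.C t)))⁻¹| ≤ (η / 2)⁻¹ := by
      filter_upwards [bZα] with t ht y
      rw [abs_inv, abs_of_pos (hZpos t y.1)]; exact inv_anti₀ hη2 (ht y)
    have bIΨ : ∀ y : {y : EuclideanSpace ℝ (Fin N) // η ≤ Ψ y}, |(Ψ y.1)⁻¹| ≤ (η / 2)⁻¹ := fun y => by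
      rw [abs_inv, abs_of_pos (hpos _)]; exact inv_anti₀ hη2 (bZ0α y)
    have uIZ2α := unifE_mul uIZα uIZα bIZα bIΨ
    have bIΨ2 : ∀ y : {y : EuclideanSpace ℝ (Fin N) // η ≤ Ψ y},
        |(Ψ y.1)⁻¹ * (Ψ y.1)⁻¹| ≤ (η / 2)⁻¹ * (η / 2)⁻¹ := fun y => by
      rw [abs_mul]; exact mul_le_mul (bIΨ y) (bIΨ y) (abs_nonneg _) (by positivity)
    -- `u_t → F`, `1/u_t → 1/F`
    have uuα := unifE_mul uWα uIZα (KA := 2 ^ 4 * B * BF)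
      (Eventually.of_forall fun t y => hWabs t y.1) bIΨ
    have uuα' : ∀ ε : ℝ, 0 < ε → ∀ᶠ t in 𝓝[Ici (0 : ℝ)] 0,
        ∀ y : {y : EuclideanSpace ℝ (Fin N) // η ≤ Ψ y},
        |(∫ ζ, Ψ (y.1 + ζ) * F (y.1 + ζ) ∂(multivariateGaussian 0 (D.C t))) *
            (∫ ζ, Ψ (y.1 + ζ) ∂(multivariateGaussian 0 (D.C t)))⁻¹ - F y.1| ≤ ε := by
      intro ε hε
      filter_upwards [uuα ε hε] with t ht y
      have h := ht y
      have hΨne : Ψ y.1 ≠ 0 := (hpos _).ne'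
      rwa [show Ψ y.1 * F y.1 * (Ψ y.1)⁻¹ = F y.1 by field_simp] at h
    have uIUα := unifE_inv uuα' ha (Eventually.of_forall fun t y => hau t y.1) fun y => haF y.1
    -- `g_{k,t} → ∂_kF`
    have ugα : ∀ k : Fin N, ∀ ε : ℝ, 0 < ε → ∀ᶠ t in 𝓝[Ici (0 : ℝ)] 0,
        ∀ y : {y : EuclideanSpace ℝ (Fin N) // η ≤ Ψ y},
        |GG k t y.1 - fderiv ℝ F y.1 (EuclideanSpace.single k 1)| ≤ ε := by
      intro k ε hε
      have h := unifE_sub (unifE_mul (uW1α k) uIZα (KA := 2 ^ 4 * B * BF)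
          (Eventually.of_forall fun t y => bW1 t k y.1) bIΨ)
        (unifE_mul uWα (unifE_mul (uZ1α k) uIZ2α (KA := B)
          (Eventually.of_forall fun t y => bZ1 t k y.1) bIΨ2) (KA := 2 ^ 4 * B * BF)
          (Eventually.of_forall fun t y => hWabs t y.1) (KB := B * ((η / 2)⁻¹ * (η / 2)⁻¹))
          (fun y => by
            rw [abs_mul]
            exact mul_le_mul ((pdZ k).2.1 y.1) (bIΨ2 y) (abs_nonneg _) hBpos.le)) ε hε
      filter_upwards [h] with t ht y
      have h1 := ht y
      rw [hprod k y.1] at h1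
      simpa only [hGG] using h1
    -- eventual bound of `g_{k,t}` on the region
    set Kg : ℝ := 2 ^ 4 * B * BF * (η / 2)⁻¹ + 2 ^ 4 * B * BF * (B * ((η / 2)⁻¹ * (η / 2)⁻¹)) with hKg
    have hKg0 : 0 ≤ Kg := by positivity
    have bgα : ∀ᶠ t in 𝓝[Ici (0 : ℝ)] 0, ∀ y : {y : EuclideanSpace ℝ (Fin N) // η ≤ Ψ y},
        ∀ k, |GG k t y.1| ≤ Kg := by
      filter_upwards [bIZα] with t ht y k
      have hI := ht y
      have hI2 : |(∫ ζ, Ψ (y.1 + ζ) ∂(multivariateGaussian 0 (D.C t)))⁻¹ *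
          (∫ ζ, Ψ (y.1 + ζ) ∂(multivariateGaussian 0 (D.C t)))⁻¹| ≤ (η / 2)⁻¹ * (η / 2)⁻¹ := by
        rw [abs_mul]; exact mul_le_mul hI hI (abs_nonneg _) (by positivity)
      simp only [hGG]
      refine (abs_sub _ _).trans (add_le_add ?_ ?_)
      · rw [abs_mul]
        exact mul_le_mul (bW1 t k y.1) hI (abs_nonneg _) hK16
      · rw [abs_mul, abs_mul]
        exact mul_le_mul (hWabs t y.1) (mul_le_mul (bZ1 t k y.1) hI2 (abs_nonneg _) hBpos.le)
          (by positivity) hK16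
    have bdF : ∀ (k : Fin N) (y : {y : EuclideanSpace ℝ (Fin N) // η ≤ Ψ y}),
        |fderiv ℝ F y.1 (EuclideanSpace.single k 1)| ≤ BF := fun k y => (hdF k).2 y.1
    -- the quadratic form
    have uAα := unifE_sum (l := 𝓝[Ici (0 : ℝ)] 0) (α := {y : EuclideanSpace ℝ (Fin N) // η ≤ Ψ y})
      (ι := Fin N) Finset.univ
      (A := fun k t y => ∑ l, D.Cdot (max t 0) k l * (GG k t y.1 * GG l t y.1))
      (A0 := fun k y => ∑ l, D.Cdot 0 k l *
        (fderiv ℝ F y.1 (EuclideanSpace.single k 1) * fderiv ℝ F y.1 (EuclideanSpace.single l 1)))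
      fun k _ => unifE_sum (l := 𝓝[Ici (0 : ℝ)] 0) (α := {y : EuclideanSpace ℝ (Fin N) // η ≤ Ψ y})
        (ι := Fin N) Finset.univ
        (A := fun l t y => D.Cdot (max t 0) k l * (GG k t y.1 * GG l t y.1))
        (A0 := fun l y => D.Cdot 0 k l *
          (fderiv ℝ F y.1 (EuclideanSpace.single k 1) * fderiv ℝ F y.1 (EuclideanSpace.single l 1)))
        fun l _ => unifE_mul (unifE_scalar (hC0 k l))
          (unifE_mul (ugα k) (ugα l) (KA := Kg) (bgα.mono fun t ht y => ht y k) (KB := BF) (bdF l))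
          (KA := KC) (Eventually.of_forall fun t _ => hKC _ (le_max_right _ _) k l) (KB := BF * BF)
          (fun y => by
            rw [abs_mul]; exact mul_le_mul (bdF k y) (bdF l y) (abs_nonneg _) hBF0)
    have bAα : ∀ᶠ t in 𝓝[Ici (0 : ℝ)] 0, ∀ y : {y : EuclideanSpace ℝ (Fin N) // η ≤ Ψ y},
        |∑ k, ∑ l, D.Cdot (max t 0) k l * (GG k t y.1 * GG l t y.1)| ≤
          ∑ _k : Fin N, ∑ _l : Fin N, |KC| * (Kg * Kg) := by
      filter_upwards [bgα] with t ht y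
      exact (Finset.abs_sum_le_sum_abs _ _).trans (Finset.sum_le_sum fun k _ =>
        (Finset.abs_sum_le_sum_abs _ _).trans (Finset.sum_le_sum fun l _ => by
          rw [abs_mul, abs_mul]
          exact mul_le_mul (bC' t k l) (mul_le_mul (ht y k) (ht y l) (abs_nonneg _) hKg0)
            (by positivity) (abs_nonneg _)))
    have uAUα := unifE_mul uAα uIUα bAα (KB := a⁻¹) (fun y => hIFb y.1)
    have uGα := unifE_mul (unifE_scalar (α := {y : EuclideanSpace ℝ (Fin N) // η ≤ Ψ y})
      (tendsto_const_nhds (x := (1 / 4 : ℝ)) (f := 𝓝[Ici (0 : ℝ)] 0))) uAUα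
      (KA := |(1 / 4 : ℝ)|) (Eventually.of_forall fun _ _ => le_rfl)
      (KB := (∑ k : Fin N, ∑ l : Fin N, |D.Cdot 0 k l| * (BF * BF)) * a⁻¹) (fun y => by
        rw [abs_mul]
        exact mul_le_mul (hSb y.1) (hIFb y.1) (abs_nonneg _) ((abs_nonneg _).trans (hSb y.1)))
    have uKα := unifE_mul uZα uGα (KA := B) (Eventually.of_forall fun t y => hZabs t y.1)
      (KB := |(1 / 4 : ℝ)| * ((∑ k : Fin N, ∑ l : Fin N, |D.Cdot 0 k l| * (BF * BF)) * a⁻¹))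
      (fun y => hG0b y.1)
    intro ε hε
    exact (uKα ε hε).mono fun t h y hy => h ⟨y, hy⟩
  ---------------------------------------------------------------- tempered convergence
  have hMd : ∀ᶠ t in 𝓝[Ici (0 : ℝ)] 0, ∀ y,
      |(∫ ζ, Ψ (y + ζ) ∂(multivariateGaussian 0 (D.C t))) *
          ((1 / 4) * ((∑ k, ∑ l, D.Cdot (max t 0) k l * (GG k t y * GG l t y)) *
            ((∫ ζ, Ψ (y + ζ) * F (y + ζ) ∂(multivariateGaussian 0 (D.C t))) *
              (∫ ζ, Ψ (y + ζ) ∂(multivariateGaussian 0 (D.C t)))⁻¹)⁻¹)) -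
        Ψ y * ((1 / 4) * ((∑ k, ∑ l, D.Cdot 0 k l *
          (fderiv ℝ F y (EuclideanSpace.single k 1) * fderiv ℝ F y (EuclideanSpace.single l 1))) *
          (F y)⁻¹))| ≤
      K0 + B * (|(1 / 4 : ℝ)| * ((∑ k : Fin N, ∑ l : Fin N, |D.Cdot 0 k l| * (BF * BF)) * a⁻¹)) :=
    Eventually.of_forall fun t y => (abs_sub _ _).trans (add_le_add (hKb t y) (by
      rw [abs_mul]; exact mul_le_mul (hΨabs y) (hG0b y) (abs_nonneg _) hBpos.le))
  have hT := tempered_of_local hc₁ hc₂ hlow hMd hloc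
  ---------------------------------------------------------------- measurability of `G_t`
  have cZ : ∀ s, Continuous fun y => ∫ ζ, Ψ (y + ζ) ∂(multivariateGaussian 0 (D.C s)) :=
    fun s => continuous_iff_continuousAt.2 fun y =>
      ((sm_pack hΨ hB (multivariateGaussian 0 (D.C s))).1 y).continuousAt
  have cW : ∀ s, Continuous fun y => ∫ ζ, Ψ (y + ζ) * F (y + ζ) ∂(multivariateGaussian 0 (D.C s)) :=
    fun s => continuous_iff_continuousAt.2 fun y =>
      ((sm_pack hΨF hBΨF (multivariateGaussian 0 (D.C s))).1 y).continuousAt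
  have cZ1 : ∀ k s, Continuous fun y => ∫ ζ, fderiv ℝ Ψ (y + ζ) (EuclideanSpace.single k 1)
      ∂(multivariateGaussian 0 (D.C s)) := fun k s =>
    continuous_iff_continuousAt.2 fun y =>
      ((sm_partial_pack hΨ hB (multivariateGaussian 0 (D.C s)) (EuclideanSpace.single k 1)).1
        y).continuousAt
  have cW1 : ∀ k s, Continuous fun y => ∫ ζ, fderiv ℝ (fun x => Ψ x * F x) (y + ζ)
      (EuclideanSpace.single k 1) ∂(multivariateGaussian 0 (D.C s)) := fun k s =>
    continuous_iff_continuousAt.2 fun y =>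
      ((sm_partial_pack hΨF hBΨF (multivariateGaussian 0 (D.C s)) (EuclideanSpace.single k 1)).1
        y).continuousAt
  have cIZ : ∀ s, Continuous fun y => (∫ ζ, Ψ (y + ζ) ∂(multivariateGaussian 0 (D.C s)))⁻¹ :=
    fun s => (cZ s).inv₀ fun y => (hZpos s y).ne'
  have cGG : ∀ k s, Continuous (GG k s) := fun k s => by
    simp only [hGG]
    exact ((cW1 k s).mul (cIZ s)).sub ((cW s).mul ((cZ1 k s).mul ((cIZ s).mul (cIZ s))))
  have hGm : ∀ t, Measurable fun y => (1 / 4) * ((∑ k, ∑ l, D.Cdot (max t 0) k l *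
      (fderiv ℝ (semigroup D V₀ 0 t F) y (EuclideanSpace.single k 1) *
        fderiv ℝ (semigroup D V₀ 0 t F) y (EuclideanSpace.single l 1))) *
      (semigroup D V₀ 0 t F y)⁻¹) := by
    intro t
    have he : (fun y => (1 / 4) * ((∑ k, ∑ l, D.Cdot (max t 0) k l *
        (fderiv ℝ (semigroup D V₀ 0 t F) y (EuclideanSpace.single k 1) *
          fderiv ℝ (semigroup D V₀ 0 t F) y (EuclideanSpace.single l 1))) *
        (semigroup D V₀ 0 t F y)⁻¹)) = fun y => (1 / 4) * ((∑ k, ∑ l, D.Cdot (max t 0) k l *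
        (GG k t y * GG l t y)) *
        ((∫ ζ, Ψ (y + ζ) * F (y + ζ) ∂(multivariateGaussian 0 (D.C t))) *
          (∫ ζ, Ψ (y + ζ) ∂(multivariateGaussian 0 (D.C t)))⁻¹)⁻¹) := by
      funext y
      simp only [hGG, ← hgf, ← hsemi]
    rw [he]
    refine (continuous_const.mul ((continuous_finsetSum _ fun k _ => continuous_finsetSum _
      fun l _ => continuous_const.mul ((cGG k t).mul (cGG l t))).mul
        (((cW t).mul (cIZ t)).inv₀ fun y => (ha.trans_le (hau t y)).ne'))).measurable
  ---------------------------------------------------------------- the tempered principle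
  have hK0e : (fun y => Real.exp (-V₀ y) * ((1 / 4) * ((∑ k, ∑ l, D.Cdot 0 k l *
      (fderiv ℝ F y (EuclideanSpace.single k 1) * fderiv ℝ F y (EuclideanSpace.single l 1))) *
      (F y)⁻¹))) = fun y => Ψ y * ((1 / 4) * ((∑ k, ∑ l, D.Cdot 0 k l *
      (fderiv ℝ F y (EuclideanSpace.single k 1) * fderiv ℝ F y (EuclideanSpace.single l 1))) *
      (F y)⁻¹)) := by
    funext y; rw [hΨV]
  have hK0m : Measurable fun y => Real.exp (-V₀ y) * ((1 / 4) * ((∑ k, ∑ l, D.Cdot 0 k l *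
      (fderiv ℝ F y (EuclideanSpace.single k 1) * fderiv ℝ F y (EuclideanSpace.single l 1))) *
      (F y)⁻¹)) := by
    rw [hK0e]; exact (hΨc.mul hG0u.continuous).measurable
  have hK0u : UniformContinuous fun y => Real.exp (-V₀ y) * ((1 / 4) * ((∑ k, ∑ l, D.Cdot 0 k l *
      (fderiv ℝ F y (EuclideanSpace.single k 1) * fderiv ℝ F y (EuclideanSpace.single l 1))) *
      (F y)⁻¹)) := by
    rw [hK0e]; exact uc_mul hΨu hG0u hΨabs hG0b
  have hK0b : ∀ y, |Real.exp (-V₀ y) * ((1 / 4) * ((∑ k, ∑ l, D.Cdot 0 k l *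
      (fderiv ℝ F y (EuclideanSpace.single k 1) * fderiv ℝ F y (EuclideanSpace.single l 1))) *
      (F y)⁻¹))| ≤ B * (|(1 / 4 : ℝ)| * ((∑ k : Fin N, ∑ l : Fin N, |D.Cdot 0 k l| * (BF * BF)) * a⁻¹)) :=
    fun y => by
      rw [hΨV, abs_mul]; exact mul_le_mul (hΨabs y) (hG0b y) (abs_nonneg _) hBpos.le
  have h := tendsto_renormExpect_nhdsWithin_zero_tempered D hVm hb
    (G := fun t y => (1 / 4) * ((∑ k, ∑ l, D.Cdot (max t 0) k l *
      (fderiv ℝ (semigroup D V₀ 0 t F) y (EuclideanSpace.single k 1) *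
        fderiv ℝ (semigroup D V₀ 0 t F) y (EuclideanSpace.single l 1))) *
      (semigroup D V₀ 0 t F y)⁻¹))
    (G0 := fun y => (1 / 4) * ((∑ k, ∑ l, D.Cdot 0 k l *
      (fderiv ℝ F y (EuclideanSpace.single k 1) * fderiv ℝ F y (EuclideanSpace.single l 1))) *
      (F y)⁻¹)) hGm hK0m hK0u hK0b
    (fun ε hε => by
      filter_upwards [hT ε hε] with t ht y
      have h1 := ht y
      simp only [hGG] at h1
      simp only [hΨV, hgf, hsemi]
      exact h1)
  rwa [renormExpect_zero D hVm hb] at h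

end Instances

end Polchinski

end Literature.Analysis.FunctionSpaces

end
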